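import Mathlib
import HarnessLib
import Literature.Analysis.FluidPDE.TypeIAncientMild
import Literature.Analysis.FluidPDE.LocalTypeI
import Literature.Analysis.FluidPDE.LocalTypeILiouville
import Literature.Analysis.FluidPDE.ClassicalSolution
import Literature.Analysis.FluidPDE.SelfSimilar
import Literature.Analysis.FluidPDE.SelfSimilarLiouville
import Summits.NavierStokesRegularity.NavierStokesRegularity.Theorems.TypeIDSSLiouvilleConjecture
import Summits.NavierStokesRegularity.NavierStokesRegularity.Theorems.SymmetryModuliCountForcedSymmetryClassEquivalence
import Summits.NavierStokesRegularity.NavierStokesRegularity.Theorems.SymmetryModuliCountForcedSymmetryRdssLiouvilleTauReduction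
import Summits.NavierStokesRegularity.NavierStokesRegularity.Theorems.SymmetryModuliCountSymmetricLiouvilleRssCoreOfConjecture

/-!
# Crux `ForcedSymmetry` (stmt-NavierStokesRegularity-4052), line `recurrent-closing` (gen 5), stub `stub_centredWall`:
# the class bridge `TypeIDSSLiouvilleConjecture ⇒ stub_centredWall`

Route `SymmetryModuliCount`, sub-problem `NavierStokesRegularity`.  Support file (everything proved, kind = proof) for
the lead's skeleton `Cruxes/ForcedSymmetry/Lines/recurrent_closing.lean` (gen 5); the registered stub `stub_centredWall`
is ALSO birth card (b) `stub_centredWall` of crux stmt-NavierStokesRegularity-8561 (`DulacContraction.RDSSLiouvilleInClass`,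
skeleton `Cruxes/RDSSLiouvilleInClass/Lines/birth.lean`), signatures verbatim.

The stub is a NAMED OPEN PROBLEM — the Type-I rotated-DSS Liouville wall (Bradshaw–Tsai 2017, OP 5.1 = Tsai 2018,
Conj. 8.8–8.9 = Pineau–Vicol 2026, Conj. 1.1) transported into Albritton–Barker's local Type-I class: a smooth slab
profile `(w, q, H)` (suitable weak on `ℝ³ × (−∞,0)`, weak gradient, `𝐈 < ∞`, rate `‖w‖ ≤ C/√(−t)`, classical on
`(−∞,0)`) which is rotated discretely self-similar about the ORIGIN a.e. on the slab,
`l • R⁻¹ w (l² t, l R x) = w (t, x)` (`l > 1`, `R ∈ O(3)`), and has space–time decay `‖w(t,x)‖ ≤ C₀/(‖x‖ + √(−t))`, is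
regular at the space–time origin.  This file proves the CONDITIONAL discharge

  `stub_centredWall_of_typeIDSSLiouvilleConjecture : TypeIDSSLiouvilleConjecture → (stub_centredWall verbatim)`,

with the canonical conjecture `Summit.NavierStokesRegularity.NavierStokesRegularity.TypeIDSSLiouvilleConjecture`
(`∀ c, TypeIDSSLiouville c ∧ ∀ R, RotatedTypeIDSSLiouville c R`) as an explicit hypothesis (never asserted).  It certifies
that the stub is AT MOST the named conjecture.

## Proof (the known-type class bridge `𝒦 ⊂ A_C` a.e.)

1. *Representative.* `exists_isTypeIAncientMild_repr_of_slabProfile` (Albritton–Barker Thm 1.1 forward + KNSS Lemma 3.1,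
   Prop. 4.1): `w = v` a.e. on the slab for some `v ∈ A_C` (`IsTypeIAncientMild C v`).  Both `w` (classical) and `v`
   (`ContDiffOn`) are continuous on the open slab `(−∞,0) × ℝ³` and Lebesgue measure charges open sets, so `w = v`
   EVERYWHERE on the open slab (`Measure.eqOn_open_of_ae_eq`).
2. *Pointwise invariance.* For the classical `w` the a.e. clause holds pointwise on `t < 0`
   (`rdssInvariant_pointwise_of_classical` with `ξ = 0`, `τ = 0`), hence so it does for `v` (the similarity maps the open
   slab into itself); the space–time decay of `w` is the space–time decay of `v` on `t < 0`.
3. *Truncation.* `V = 𝟙_{t<0} v` lies in `A_{2C}` (`isTypeIAncientMild_truncate`), is rotated `l`-DSS for ALL times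
   (both sides vanish for `t ≥ 0`), is an ancient mild solution in the duality sense
   (`IsTypeIAncientMild.isAncientMildSolution`) with continuous, hence a.e.-strongly measurable, slices, and has the decay.
4. *Conclusion.* `RotatedTypeIDSSLiouville l R` (the `R`-half of the conjecture at `c = l`) makes every slice `v t`,
   `t < 0`, a.e. zero, hence zero (`Continuous.ae_eq_iff_eq`); so `w = 0` on the open slab, `w = 0` a.e. on
   `Q((0,0),1) ⊆` slab (`parabolicCylinder_origin_subset_slab`), and the origin is not a backward singular point.

No new definitions; trust base: the conjecture hypothesis and Mathlib's axioms.

References: Z. Bradshaw, T.-P. Tsai, Comm. PDE 42 (2017), §5 OP 5.1 [BradshawTsai2017CPDE]; T.-P. Tsai, *Lectures on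
Navier–Stokes equations*, GSM 192 (2018), Conj. 8.8–8.9 [Tsai2018]; B. Pineau, V. Vicol (2026), Conj. 1.1
[PineauVicol2026]; D. Albritton, T. Barker, J. Math. Fluid Mech. 21 (2019), Thm 1.1, §3 [AlbrittonBarker2019]; G. Koch,
N. Nadirashvili, G. Seregin, V. Šverák, Acta Math. 203 (2009), Lemma 3.1, Prop. 4.1 [KochNadirashviliSereginSverak2009].
-/

noncomputable section

-- the summit and its single problem share the name (D-0017 nested layout)
set_option linter.dupNamespace false

open MeasureTheory Set Function Filter
open scoped ENNReal
open Literature.Analysis.FluidPDE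

namespace Summit.NavierStokesRegularity.NavierStokesRegularity.Theorems.SymmetryModuliCountForcedSymmetry

/-- **`stub_centredWall ⇐ TypeIDSSLiouvilleConjecture` (class bridge; CONDITIONAL on the conjecture hypothesis).**
Under the canonical open conjecture `TypeIDSSLiouvilleConjecture` (Bradshaw–Tsai 2017, OP 5.1; Tsai 2018, Conj. 8.8–8.9;
Pineau–Vicol 2026, Conj. 1.1), a smooth slab profile of Albritton–Barker's local Type-I class (suitable weak on
`ℝ³ × (−∞,0)` with weak gradient `H`, `𝐈 < ∞`, rate `C/√(−t)`, classical on `(−∞,0)`) which is rotated discretely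
self-similar about the origin a.e. on the slab (`l • R⁻¹ w (l² t, l R x) = w (t,x)`, `l > 1`) and has space–time Type-I
decay `HasTypeIDecay C₀ w` is regular at the origin: `w` equals an element `v ∈ A_C` everywhere on the open slab
(`exists_isTypeIAncientMild_repr_of_slabProfile` + continuity), the invariance is pointwise
(`rdssInvariant_pointwise_of_classical`), the truncation `𝟙_{t<0} v ∈ A_{2C}` is rotated `l`-DSS at all times with
measurable slices and the decay, so `RotatedTypeIDSSLiouville l R` kills every slice; hence `w = 0` on the slab.
[cite: BradshawTsai2017CPDE, §5 Open Problem 5.1; AlbrittonBarker2019, Thm 1.1, §3] -/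
theorem stub_centredWall_of_typeIDSSLiouvilleConjecture :
    _root_.Summit.NavierStokesRegularity.NavierStokesRegularity.TypeIDSSLiouvilleConjecture →
    ∀ (w : ℝ → EuclideanSpace ℝ (Fin 3) → EuclideanSpace ℝ (Fin 3)) (q : ℝ → EuclideanSpace ℝ (Fin 3) → ℝ)
      (H : ℝ → EuclideanSpace ℝ (Fin 3) → EuclideanSpace ℝ (Fin 3) →L[ℝ] EuclideanSpace ℝ (Fin 3)) (C : ℝ),
      IsSuitableWeakSolutionOn (slab (EuclideanSpace ℝ (Fin 3)) (Set.Iio 0) isOpen_Iio) 1 0 w q →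
      HasWeakSpatialGradientOn (slab (EuclideanSpace ℝ (Fin 3)) (Set.Iio 0) isOpen_Iio) w H →
      typeIBound (Set.Iio (0 : ℝ) ×ˢ Set.univ) w q H < ⊤ →
      HasTypeITimeDecay C w →
      IsClassicalNSSolutionOn (Set.Iio 0) 1 0 w q →
      ∀ (l : ℝ) (R : EuclideanSpace ℝ (Fin 3) ≃ₗᵢ[ℝ] EuclideanSpace ℝ (Fin 3)), 1 < l →
        (fun z : ℝ × EuclideanSpace ℝ (Fin 3) => l • R.symm (w (l ^ 2 * z.1) (l • R z.2)))
          =ᵐ[volume.restrict (Set.Iio (0 : ℝ) ×ˢ Set.univ)]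
            (fun z : ℝ × EuclideanSpace ℝ (Fin 3) => w z.1 z.2) →
        (∃ C₀ : ℝ, HasTypeIDecay C₀ w) →
        ¬ IsBackwardSingularPoint w 0 := by
  intro hConj w q H C hsw _hwg hI hdec hcl l R hl hinv hK
  have hl0 : 0 < l := zero_lt_one.trans hl
  have hneg : ∀ t < (0 : ℝ), l ^ 2 * t < 0 := fun t ht => mul_neg_of_pos_of_neg (by positivity) ht
  have hSm : MeasurableSet (Iio (0 : ℝ) ×ˢ (univ : Set (EuclideanSpace ℝ (Fin 3)))) :=
    measurableSet_Iio.prod MeasurableSet.univ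
  -- Step 1: an `A_C` representative `v`, equal to `w` everywhere on the open slab
  obtain ⟨v, hv, hae⟩ := exists_isTypeIAncientMild_repr_of_slabProfile hsw hdec hI
  have hS : IsOpen (Iio (0 : ℝ) ×ˢ (univ : Set (EuclideanSpace ℝ (Fin 3)))) := isOpen_Iio.prod isOpen_univ
  have hwv : EqOn (uncurry w) (uncurry v) (Iio (0 : ℝ) ×ˢ (univ : Set (EuclideanSpace ℝ (Fin 3)))) :=
    Measure.eqOn_open_of_ae_eq hae hS hcl.smooth_velocity.continuousOn hv.continuousOn_uncurry
  have hwv' : ∀ t < (0 : ℝ), ∀ x : EuclideanSpace ℝ (Fin 3), w t x = v t x := fun t ht x =>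
    hwv (show ((t, x) : ℝ × EuclideanSpace ℝ (Fin 3)) ∈ Iio (0 : ℝ) ×ˢ (univ : Set (EuclideanSpace ℝ (Fin 3)))
      from ⟨ht, mem_univ _⟩)
  -- Step 2: the a.e. clause is pointwise on `t < 0` for the classical `w`, hence for `v`
  have hinv0 : (fun z : ℝ × EuclideanSpace ℝ (Fin 3) => l • R.symm (w (l ^ 2 * z.1 + 0) (l • R z.2 + 0)))
      =ᵐ[volume.restrict (Iio (0 : ℝ) ×ˢ (univ : Set (EuclideanSpace ℝ (Fin 3))))]
        (fun z : ℝ × EuclideanSpace ℝ (Fin 3) => w z.1 z.2) := by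
    simpa only [add_zero] using hinv
  have hptw : ∀ t < (0 : ℝ), ∀ x : EuclideanSpace ℝ (Fin 3), l • R.symm (w (l ^ 2 * t) (l • R x)) = w t x := by
    intro t ht x
    simpa only [add_zero] using rdssInvariant_pointwise_of_classical R 0 hcl hl0 le_rfl hinv0 t ht x
  have hptv : ∀ t < (0 : ℝ), ∀ x : EuclideanSpace ℝ (Fin 3), l • R.symm (v (l ^ 2 * t) (l • R x)) = v t x := by
    intro t ht x
    rw [← hwv' _ (hneg t ht), ← hwv' t ht x]
    exact hptw t ht x
  -- Step 3: the truncation `V = 𝟙_{t<0} v` lies in `A_{2C}`, is rotated `l`-DSS at all times, decays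
  obtain ⟨V, hV⟩ : ∃ V : ℝ → EuclideanSpace ℝ (Fin 3) → EuclideanSpace ℝ (Fin 3),
      V = fun s => if s < 0 then v s else 0 := ⟨_, rfl⟩
  have hV_neg : ∀ s < 0, V s = v s := fun s hs => by
    rw [hV]
    exact if_pos hs
  have hV_nonneg : ∀ s : ℝ, ¬ s < 0 → V s = 0 := fun s hs => by
    rw [hV]
    exact if_neg hs
  have hVclass : IsTypeIAncientMild (2 * C) V :=
    hV ▸ Summit.NavierStokesRegularity.NavierStokesRegularity.Theorems.SymmetryModuliCountSymmetricLiouville.isTypeIAncientMild_truncate hv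
  have hdss : IsRotatedDSS l R V := by
    intro s y
    by_cases hs : s < 0
    · rw [hV_neg s hs, hV_neg _ (hneg s hs)]
      exact hptv s hs y
    · have hcs : ¬ l ^ 2 * s < 0 := not_lt.2 (mul_nonneg (sq_nonneg _) (not_lt.1 hs))
      rw [hV_nonneg s hs, hV_nonneg _ hcs]
      simp
  have hmeas : ∀ s < 0, AEStronglyMeasurable (V s) volume := fun s hs =>
    hVclass.aestronglyMeasurable_slice hs
  have hdecV : ∃ K : ℝ, HasTypeIDecay K V := by
    obtain ⟨K, hKw⟩ := hK
    refine ⟨K, fun s hs y => ?_⟩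
    rw [hV_neg s hs, ← hwv' s hs y]
    exact hKw s hs y
  -- Step 4: the conjecture (rotated half at `c = l`) kills every slice; continuous slices a.e. zero are zero
  have hw0 : ∀ t < (0 : ℝ), ∀ x : EuclideanSpace ℝ (Fin 3), w t x = 0 := by
    intro t ht x
    have hae0 : V t =ᵐ[volume] 0 :=
      (hConj l).2 R hl V hVclass.isAncientMildSolution hmeas hdss hdecV t ht
    rw [hV_neg t ht] at hae0
    have h0 : v t = 0 :=
      (Continuous.ae_eq_iff_eq volume (hv.continuous_slice ht) continuous_const).1 hae0
    rw [hwv' t ht x, h0, Pi.zero_apply]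
  intro hsing
  have hzero : ∀ᵐ z ∂(volume.restrict (Iio (0 : ℝ) ×ˢ (univ : Set (EuclideanSpace ℝ (Fin 3))))),
      uncurry w z = (0 : ℝ × EuclideanSpace ℝ (Fin 3) → EuclideanSpace ℝ (Fin 3)) z := by
    filter_upwards [ae_restrict_mem hSm] with z hz
    exact hw0 z.1 hz.1 z.2
  have hsub : parabolicCylinder 1 (0 : ℝ × EuclideanSpace ℝ (Fin 3)) ⊆
      Iio (0 : ℝ) ×ˢ (univ : Set (EuclideanSpace ℝ (Fin 3))) :=
    parabolicCylinder_origin_subset_slab 1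
  have h1 := hsing 1 one_pos
  rw [eLpNorm_congr_ae (ae_restrict_of_ae_restrict_of_subset hsub hzero), eLpNorm_zero] at h1
  exact ENNReal.zero_ne_top h1

end Summit.NavierStokesRegularity.NavierStokesRegularity.Theorems.SymmetryModuliCountForcedSymmetry

end
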